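import Summits.QuantumFields.YangMills.Theorems.AlphaInputsT3ACMinimiserPin
import Summits.QuantumFields.YangMills.Theorems.UnitScaleTiltFluctuationComparisonRegPrOneStepSubmersion
import Summits.QuantumFields.YangMills.Theorems.UnitScaleTiltThm1GuardedFiveResidueThree
import Mathlib.Topology.Semicontinuity.Basic
import HarnessLib

/-!
# S2β · THE BACKGROUND ACTION IS CONTINUOUS IN THE DATUM ON THE WINDOW — `V ↦ minActionRegPr F n K ε₀ V` is `ContinuousOn` every small
# plaquette class, from [Balaban1985Variational] Thm 1 (8) alone (hence OUTRIGHT at every block size `L ≥ 5`)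

Cell `ym3-torus` (YM ladder rung R3 = continuum `SU(2)` Yang–Mills on the three-torus at fixed lattice data — a RUNG: NOT d = 4, NOT infinite volume,
NOT a mass gap, NOT Clay).  Width seat `ym3-torus-px10` (gen 20), WIDTH COPY of ★p1; helper of the crux `stmt-QuantumFields-20520`
(`…Theses.UnitScaleTilt.FluctuationComparisonRegPrIntL`), `--supports … --as helper`, count-neutral, DEFINITION-FREE (0 `def`, 0 `instance`,
0 `notation`, 0 `sorry`, default heartbeats).

WHY.  The tree-level part of S2β's integrand is `β_K · minActionRegPr F J K hJK ε₀ V` (registry `Lines/semiclassical_s2beta.lean` :329, `fluctAtCan`;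
`FluctuationPartSmall` :427–430), the minimum of the Wilson action over PRINT'S REGULAR SPACE (6) = `regFibrePr F J K hJK ε₀ V` (an `sInf` over an
OPEN constraint set inside the descent fibre of `V`).  Every a.e.→everywhere upgrade of a four-point row on the open window (✓px10 g19 FILE J
`…LargeFieldGasFourPtOfAEIdentity.forall_abs_le_of_ae_of_continuousOn`, UV3-NODE §45.7) needs the TESTED function continuous there; for the
small-field rows that function is `log heightDensityCan + β_K·minActionRegPr`, whose first summand is continuous on the window by ✓WREG, and whose
second summand had NO continuity statement in the tree.  Print has MORE: [Balaban1985Variational] Prop. 9 p.309 / (190) — the background field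
`U_k(V)` is ANALYTIC in `V`; this file is its `C⁰` shadow, obtained from Thm 1 (8) (global reading, the tree's `Thm1GlobalMinAt`) by Berge's argument.

MECHANISM (numbers, not adjectives).  Write `m(V) := minActionRegPr F n K _ ε₀ V = sInf A(regFibrePr ε₀ V)`, `π := descendTo F ℰp n K`, `A := wilsonAction4`.
* LOWER semicontinuity on `{PlaqSmall ε₁}` (§1 `lowerSemicontinuousWithinAt_of_isCompact`, §3): Thm 1 (8) puts a minimiser over (6)(`ε₀`) into
  (8)(`B₃ε₁`); for `B₃ε₁ < ε₀` the CLOSED class `C := {|U(∂p) − 1| ≤ regThreshold(B₃ε₁)} ∩ {‖D*∂U‖ ≤ B₃ε₁·L^{−3(K−n)}}` is compact, feasible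
  (`C ⊆ 𝔘_k(ε₀)`), and `π` is continuous on it (✓`MinimiserPin.continuousAt_descendTo_of_plaqLe`, [Balaban1985Averaging] Prop. 2); so `π(C ∩ {A ≤ t})` is
  closed and misses `V₀` whenever `t < m(V₀)`.
* UPPER semicontinuity (§1 `upperSemicontinuousAt_of_isOpen_image`, §2, §3): `π` is an OPEN MAP on the open set of fields whose whole history is
  `2ε₀`-small — one (0.4) step is open on small fields (✓`OneStepSubmersion.oneStepSubmersion` (O), the 19201 fleet's inverse-function theorem on `SU(2)`),
  iterate `K − n` times (§2 `isOpen_image_iter_blockAvg`), then the level identification `fieldShift` is a homeomorphism (§2 `isOpen_image_descendTo`);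
  every `U ∈ 𝔘_k(ε₀)` has a `2ε₀`-small history (Prop. 2 (53), ✓`MinimiserPin.plaqSmall_two_iter_blockAvg`); so the image of the open set
  `𝔘_k(ε₀) ∩ {A < m(V₀) + ε}` (it contains the minimiser) is an open neighbourhood of `V₀` on which `m < m(V₀) + ε`.
* §4: ★★ `continuousOn_minActionRegPr_five` (every `L ≥ 5`, ZERO hypotheses, via ✓`thm1GlobalMinAt_five`); window editions in the route's letters `θBal`
  (★★ `continuousOn_minActionRegPr_window_of_thm1`, ★★ `…_window_five`).  Smallness of `ε₀` = print's (53)-admissibility of `2ε₀` (letters of ✓`MinimiserPin`).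

HONEST.  Topology (Berge's maximum theorem, split into its two halves) over landed theorems; the analytic inputs are the tree's (Thm 1 (8) at `L ≥ 5` =
✓`Thm1GuardedFiveResidueThree.thm1GlobalMinAt_five`; the one-step submersion ✓`oneStepSubmersion`; Prop. 2 ✓`plaqSmall_iter_blockAvg_eml_level`); nothing of
Bałaban's analysis is added; print's Prop. 9 (analyticity in `V`) is NOT proved; the five registered ∘-stubs, S2β, crux 20520, 19936, 19200 and `YM3TorusSU2`
are NOT proved; `L = 3` stays behind the Thm-1 letter; no summit statement is proved by a helper; rung R3 = SU(2) YM₃ on T³ at fixed lattice data — NOT d = 4,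
NOT infinite volume, NOT a mass gap, NOT Clay; the Yang–Mills mass gap is NOT proved.  Axioms standard.

References: T. Bałaban, CMP **102** (1985) 277–309 [Balaban1985Variational] ((2)–(8) p.278–279, Thm 1 p.279, Prop. 9 p.309); CMP **98** (1985) 17–51 [Balaban1985Averaging]
(Prop. 2 (52)–(54) p.26); CMP **109** (1987) 249–301 [Balaban1987RG1] ((0.4), (0.11) p.253); C. Berge, *Espaces topologiques, fonctions multivoques* (1959) Ch. VI §3.
-/

set_option autoImplicit false

noncomputable section

namespace Summit.QuantumFields.YangMills.Theorems.FluctuationComparisonRegPrIntLS2BetaMinActionRegPrContinuousOn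

open Set Filter Topology
open scoped Matrix.Norms.L2Operator
open Literature.MathematicalPhysics.QuantumFieldTheory.Balaban1983to89
open Literature.MathematicalPhysics.QuantumFieldTheory.Balaban1983to89.T3ContinuumYM3Torus
open Literature.MathematicalPhysics.QuantumFieldTheory.Balaban1983to89.T3UnitLawDensityEML (ℰp)
open Literature.MathematicalPhysics.QuantumFieldTheory.Balaban1983to89.T3UnitScaleTilt (θBal)
open Literature.MathematicalPhysics.QuantumFieldTheory.Balaban1983to89.T3PrintedRegularMinimiser
  (RegPr DivSmall regFibrePr minActionRegPr mem_regFibrePr_iff minActionRegPr_le)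
open Literature.MathematicalPhysics.QuantumFieldTheory.Balaban1983to89.T3PrintedMinimiserExistence
  (Thm1GlobalMinAt regFibrePr_mono plaqSmall_of_le regThreshold_mono minActionRegPr_eq_of_isMinOn)
open Literature.MathematicalPhysics.QuantumFieldTheory.Balaban1983to89.T3RegularMinimiser (regThreshold regFibre regThreshold_pos)
open Literature.MathematicalPhysics.QuantumFieldTheory.Balaban1983to89.T3ConstrainedMinimiser (fibre)
open Literature.MathematicalPhysics.QuantumFieldTheory.Balaban1983to89.T3DescentFibreTower (mem_fibre_iff)
open Literature.MathematicalPhysics.QuantumFieldTheory.Balaban1983to89.T3TiltDescent (descendTo)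
open Literature.MathematicalPhysics.QuantumFieldTheory.Balaban1983to89.T3LevelShift
  (fieldShift fieldShift_fieldShift_symm fieldShift_symm_fieldShift)
open Literature.MathematicalPhysics.QuantumFieldTheory.Balaban1983to89.T3MinimiserStabilityReduction (θBal_pos)
open Literature.MathematicalPhysics.QuantumFieldTheory.Balaban1983to89.T3ThresholdSmallness (exists_forall_θBal_le)
open Literature.MathematicalPhysics.QuantumFieldTheory.Balaban1983to89.B10Eq27TorusAxialLog (toUField unitsField)
open Literature.MathematicalPhysics.QuantumFieldTheory.Balaban1983to89.B10Eq68TorusRegularity (covDivT)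
open Literature.MathematicalPhysics.QuantumFieldTheory.Balaban1983to89.ExpMeanLog (expMeanLogSU deltaSU deltaSU_pos)
open Literature.MathematicalPhysics.QuantumFieldTheory.Balaban1983to89.BlockAveraging (blockAvg)
open Summit.QuantumFields.YangMills.BalabanUVNodes.N07DirectMethod (continuous_wilsonAction4 continuous_dist1_plaqHol isCompact_of_isClosed_cfg)
open Summit.QuantumFields.YangMills.Theorems.Prop8Criticality (continuous_covDivT)
open Summit.QuantumFields.YangMills.Theorems.MinimiserPin
  (plaqSmall_two_iter_blockAvg continuousAt_descendTo_of_plaqLe isClosed_plaqLe isClosed_divLe continuous_fieldShift regThreshold_eq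
    loopRadius_lt_deltaSU)
open Summit.QuantumFields.YangMills.Theorems.OneStepSubmersion (oneStepSubmersion)
open Summit.QuantumFields.YangMills.Theorems.Thm1GuardedFiveResidueThree (thm1GlobalMinAt_five)

/-! ## §1 Berge's two halves, abstractly: a constrained infimum along the fibres of a map -/

section Abstract

variable {X Y : Type*} [TopologicalSpace X] [TopologicalSpace Y]

/-- **UPPER SEMICONTINUITY FROM AN OPEN CONSTRAINT MAP.**  Let `m : Y → ℝ` be dominated along an open set `O₀ ⊆ X` by `A` (`m (π x) ≤ A x` for `x ∈ O₀`),
let `π` map open subsets of `O₀` to open sets, and let `x₀ ∈ O₀` realise `m (π x₀)` up to `A x₀ ≤ m (π x₀)` with `A` continuous at `x₀`.  Then `m` is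
upper semicontinuous at `π x₀`.  [cite: Balaban1985Variational, Thm 1 (8) p.279 (the use); folklore: Berge's maximum theorem, upper half] -/
theorem upperSemicontinuousAt_of_isOpen_image {π : X → Y} {A : X → ℝ} {m : Y → ℝ} {O₀ : Set X} {x₀ : X}
    (hO₀ : IsOpen O₀) (hπ : ∀ O : Set X, IsOpen O → O ⊆ O₀ → IsOpen (π '' O))
    (hle : ∀ x ∈ O₀, m (π x) ≤ A x) (hx₀ : x₀ ∈ O₀) (hA : ContinuousAt A x₀) (hmin : A x₀ ≤ m (π x₀)) :
    UpperSemicontinuousAt m (π x₀) := by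
  intro y hy
  have hlt : A x₀ < y := hmin.trans_lt hy
  have hN₁ : A ⁻¹' Iio y ∈ 𝓝 x₀ := hA.preimage_mem_nhds (Iio_mem_nhds hlt)
  obtain ⟨N₁, hN₁sub, hN₁o, hx₀N₁⟩ := mem_nhds_iff.mp hN₁
  have hNo : IsOpen (π '' (O₀ ∩ N₁)) := hπ _ (hO₀.inter hN₁o) inter_subset_left
  have hmem : π x₀ ∈ π '' (O₀ ∩ N₁) := mem_image_of_mem π ⟨hx₀, hx₀N₁⟩
  filter_upwards [hNo.mem_nhds hmem] with y' hy'
  obtain ⟨x, ⟨hxO, hxN⟩, rfl⟩ := hy'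
  exact (hle x hxO).trans_lt (hN₁sub hxN)

/-- **LOWER SEMICONTINUITY FROM COMPACTNESS OF THE FEASIBLE CLASS.**  Let `C ⊆ X` be compact, `π` continuous on `C`, `A` continuous, `m (π x) ≤ A x` on `C`,
and suppose `m` is ATTAINED inside `C` over every point of `W` (`∃ x ∈ C, π x = y ∧ A x = m y`).  Then `m` is lower semicontinuous within `W` at every
point `y₀`: the set `π(C ∩ {A ≤ t})` is compact, hence closed, and misses `y₀` when `t < m y₀`.  [cite: Balaban1985Variational, Thm 1 (8) p.279 (the use); folklore: Berge's maximum theorem, lower half] -/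
theorem lowerSemicontinuousWithinAt_of_isCompact [T2Space Y] {π : X → Y} {A : X → ℝ} {m : Y → ℝ} {C : Set X} {W : Set Y} {y₀ : Y}
    (hC : IsCompact C) (hπ : ContinuousOn π C) (hA : Continuous A) (hle : ∀ x ∈ C, m (π x) ≤ A x)
    (hatt : ∀ y ∈ W, ∃ x ∈ C, π x = y ∧ A x = m y) :
    LowerSemicontinuousWithinAt m W y₀ := by
  intro t ht
  set Z : Set Y := π '' (C ∩ {x | A x ≤ t}) with hZ_def
  have hZc : IsCompact Z :=
    (hC.inter_right (isClosed_le hA continuous_const)).image_of_continuousOn (hπ.mono inter_subset_left)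
  have hZ : IsClosed Z := hZc.isClosed
  have hy₀Z : y₀ ∉ Z := by
    rintro ⟨x, ⟨hxC, hxt⟩, hxy⟩
    have h1 : m y₀ ≤ A x := hxy ▸ hle x hxC
    exact (lt_irrefl _) ((h1.trans hxt).trans_lt ht)
  have hn : Zᶜ ∈ 𝓝[W] y₀ := mem_nhdsWithin_of_mem_nhds (hZ.isOpen_compl.mem_nhds hy₀Z)
  filter_upwards [hn, self_mem_nhdsWithin] with y hyZ hyW
  obtain ⟨x, hxC, hxy, hxm⟩ := hatt y hyW
  by_contra hcon
  exact hyZ ⟨x, ⟨hxC, show A x ≤ t by rw [hxm]; exact not_lt.mp hcon⟩, hxy⟩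

end Abstract

/-! ## §2 The descent `D_{n,K}` is an OPEN MAP on the fields with a small history -/

section OpenMap

variable (F : T3Family)

/-- **THE `k`-FOLD (0.4) AVERAGE MAPS OPEN SETS OF FIELDS WITH `δ`-SMALL HISTORY TO OPEN SETS** (`k ≤ m + K`, `((5L)²/4)·δ < δ₂`): induction on `k`, one
step being ✓`OneStepSubmersion.oneStepSubmersion` (O) on the open `δ`-small image of the previous step. [cite: Balaban1987RG1, (0.4) and (0.11) p.253] -/
theorem isOpen_image_iter_blockAvg {K : ℕ} {δ : ℝ} (hδ : 0 ≤ δ)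
    (hτ : ((((F.P K).d + 2) * (F.P K).L : ℕ) : ℝ) ^ 2 / 4 * δ < deltaSU (Fin 2)) :
    ∀ (k : ℕ), k ≤ (F.P K).m + (F.P K).K → ∀ (O : Set (GaugeField (F.P K) 0 (Matrix.specialUnitaryGroup (Fin 2) ℂ))), IsOpen O →
      (∀ U ∈ O, ∀ i, i < k → PlaqSmall δ (Averaging.iter (fun i => blockAvg (P := F.P K) (j := i) ℰp) i U)) →
      IsOpen (Averaging.iter (fun i => blockAvg (P := F.P K) (j := i) ℰp) k '' O)
  | 0, _, O, hO, _ => by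
      have h0 : Averaging.iter (fun i => blockAvg (P := F.P K) (j := i) ℰp) 0 '' O = O := by
        refine Set.ext fun U => ⟨?_, fun hU => ⟨U, hU, rfl⟩⟩
        rintro ⟨U', hU', rfl⟩
        exact hU'
      rw [h0]
      exact hO
  | k + 1, hk, O, hO, hsmall => by
      have IH := isOpen_image_iter_blockAvg hδ hτ k (Nat.le_of_succ_le hk) O hO
        (fun U hU i hi => hsmall U hU i (Nat.lt_succ_of_lt hi))
      have himg : Averaging.iter (fun i => blockAvg (P := F.P K) (j := i) ℰp) (k + 1) '' O =
          (blockAvg (P := F.P K) (j := k) ℰp).avg '' (Averaging.iter (fun i => blockAvg (P := F.P K) (j := i) ℰp) k '' O) := by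
        rw [Set.image_image]
        rfl
      rw [himg]
      refine (oneStepSubmersion (P := F.P K) (j := k) hk hδ hτ IH ?_).1
      rintro _ ⟨U, hU, rfl⟩
      exact hsmall U hU k (Nat.lt_succ_self k)

/-- ★ **`D_{n,K}` IS AN OPEN MAP ON THE FIELDS WITH `δ`-SMALL HISTORY**: for every open `O` all of whose members have `δ`-small `i`-fold averages
(`i < K − n`, `((5L)²/4)·δ < δ₂`), `descendTo F ℰp n K h '' O` is open — §2's iterate followed by the level identification `fieldShift`, a homeomorphism.
[cite: Balaban1987RG1, (0.4) and (0.11) p.253] -/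
theorem isOpen_image_descendTo {n K : ℕ} (h : n ≤ K) {δ : ℝ} (hδ : 0 ≤ δ)
    (hτ : ((((F.P K).d + 2) * (F.P K).L : ℕ) : ℝ) ^ 2 / 4 * δ < deltaSU (Fin 2))
    (O : Set (GaugeField (F.P K) 0 (Matrix.specialUnitaryGroup (Fin 2) ℂ))) (hO : IsOpen O)
    (hsmall : ∀ U ∈ O, ∀ i, i < K - n → PlaqSmall δ (Averaging.iter (fun i => blockAvg (P := F.P K) (j := i) ℰp) i U)) :
    IsOpen (descendTo F ℰp n K h '' O) := by
  have hh : (F.PP F.m n).sitesPerDir 0 = (F.PP F.m K).sitesPerDir (K - n) :=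
    F.sitesPerDir_eq (m := F.m) (K := n) (j := 0) (m' := F.m) (K' := K) (j' := K - n) (by omega)
  have h1 := isOpen_image_iter_blockAvg F hδ hτ (K - n) (by show K - n ≤ F.m + K; omega) O hO hsmall
  have heq : descendTo F ℰp n K h '' O =
      fieldShift (G := Matrix.specialUnitaryGroup (Fin 2) ℂ) hh ''
        (Averaging.iter (fun i => blockAvg (P := F.P K) (j := i) ℰp) (K - n) '' O) := by
    rw [Set.image_image]
    rfl
  rw [heq, congr_fun (Set.image_eq_preimage_of_inverse (fieldShift_fieldShift_symm hh) (fieldShift_symm_fieldShift hh)) _]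
  exact h1.preimage (continuous_fieldShift F hh.symm)

end OpenMap

/-! ## §3 ★★★ The regular minimal action is continuous in the datum on every small plaquette class -/

section Main

variable (F : T3Family)

/-- **PRINT'S REGULAR SPACE `𝔘_k(ε₀)` CUT BY AN ACTION LEVEL IS OPEN**: `{U | RegPr F n K ε₀ U ∧ A(U) < t}` is open (finitely many strict inequalities of
continuous functions of the configuration). [cite: Balaban1985Variational, (2) and (5) p.278] -/
theorem isOpen_regPr_inter_actionLt (n K : ℕ) (ε₀ t : ℝ) :
    IsOpen {U : GaugeField (F.P K) 0 (Matrix.specialUnitaryGroup (Fin 2) ℂ) | RegPr F n K ε₀ U ∧ wilsonAction4 U < t} := by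
  have hset : {U : GaugeField (F.P K) 0 (Matrix.specialUnitaryGroup (Fin 2) ℂ) | RegPr F n K ε₀ U ∧ wilsonAction4 U < t} =
      ((⋂ p : Plaq (F.P K) 0, {U | GaugeGroup.dist1 (GaugeField.plaqHol U p) < regThreshold F n K ε₀}) ∩
        ⋂ b : PBond (F.P K) 0, {U | ‖covDivT 1 (unitsField (toUField U)) b.dir b.src‖ < ε₀ * ((F.L : ℝ)⁻¹) ^ (3 * (K - n))}) ∩
      {U | wilsonAction4 U < t} := by
    ext U
    simp only [mem_setOf_eq, mem_inter_iff, mem_iInter, RegPr, PlaqSmall, DivSmall]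
  rw [hset]
  refine IsOpen.inter (IsOpen.inter ?_ ?_) (isOpen_lt (continuous_wilsonAction4 (N := 2)) continuous_const)
  · exact isOpen_iInter_of_finite fun p => isOpen_lt (continuous_dist1_plaqHol (N := 2) p) continuous_const
  · exact isOpen_iInter_of_finite fun b => isOpen_lt (continuous_covDivT b.dir b.src).norm continuous_const

/-- **EVERY PRINT-REGULAR CONFIGURATION HAS A `2ε₀`-SMALL HISTORY** ([Balaban1985Averaging] Prop. 2 (53), `2ε₀` admissible): `U ∈ 𝔘_k(ε₀)` ⇒
`|Ū^i(∂p) − 1| < 2ε₀` for every `i ≤ K − n`. [cite: Balaban1985Averaging, Prop. 2 (52)-(54) p.26] -/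
theorem plaqSmall_iter_of_regPr {n K : ℕ} {ε₀ : ℝ} (hε₀ : 0 < ε₀)
    (hr3 : (143 * ((((3 + 4 : ℕ) : ℝ)) ^ 2 / 4) ^ 2) * (2 * ε₀) ≤ 1 / 3)
    (hr2 : 2 * (2 * ε₀) ≤ 2 * deltaSU (Fin 2) / (((3 + 4) * F.L : ℕ) : ℝ) ^ 2)
    {U : GaugeField (F.P K) 0 (Matrix.specialUnitaryGroup (Fin 2) ℂ)} (hU : RegPr F n K ε₀ U) {i : ℕ} (hi : i ≤ K - n) :
    PlaqSmall (2 * ε₀) (Averaging.iter (fun i => blockAvg (P := F.P K) (j := i) ℰp) i U) := by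
  have hα3 : (143 * ((((3 + 4 : ℕ) : ℝ)) ^ 2 / 4) ^ 2) * ε₀ ≤ 1 / 3 := by
    have h0 : (0 : ℝ) ≤ 143 * ((((3 + 4 : ℕ) : ℝ)) ^ 2 / 4) ^ 2 := by positivity
    nlinarith
  have hα2 : 2 * ε₀ ≤ 2 * deltaSU (Fin 2) / (((3 + 4) * F.L : ℕ) : ℝ) ^ 2 := by linarith
  have h52 : PlaqSmall (ε₀ * ((((F.P K).L : ℝ) ^ (K - n))⁻¹) ^ 2) U := by
    have h := hU.1
    rw [regThreshold_eq F n K ε₀] at h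
    exact h
  exact plaqSmall_two_iter_blockAvg (N := 2) (P := F.P K) (K - n) hε₀ hα3 hα2 h52 hi

/-- ★★★ **THE BACKGROUND ACTION IS CONTINUOUS IN THE DATUM**: under [Balaban1985Variational] Thm 1 (8) in the global reading at block size `L`
(`Thm1GlobalMinAt L a₀ a₁ B₃`), for radii `0 < ε₁ ≤ a₁`, `B₃ε₁ < ε₀ ≤ a₀` (STRICT middle inequality: the space (8) sits strictly inside (6)) and `2ε₀`
admissible as in [Balaban1985Averaging] (53), the minimum of the Wilson action over print's regular space (6), `V ↦ minActionRegPr F n K _ ε₀ V`, is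
CONTINUOUS ON the plaquette class `{V | |V(∂p) − 1| < ε₁ ∀ p}` (`n < K`). [cite: Balaban1985Variational, Thm 1 (8) p.279 and Prop 9 p.309] -/
theorem continuousOn_minActionRegPr {L : ℕ} {a₀ a₁ B₃ : ℝ} (hT : Thm1GlobalMinAt L a₀ a₁ B₃) (hB₃ : 0 < B₃) (hF : F.L = L)
    {n K : ℕ} (hnK : n < K) {ε₁ ε₀ : ℝ} (hε₁ : 0 < ε₁) (hε₁a : ε₁ ≤ a₁) (hlo : B₃ * ε₁ < ε₀) (hhi : ε₀ ≤ a₀)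
    (hr3 : (143 * ((((3 + 4 : ℕ) : ℝ)) ^ 2 / 4) ^ 2) * (2 * ε₀) ≤ 1 / 3)
    (hr2 : 2 * (2 * ε₀) ≤ 2 * deltaSU (Fin 2) / (((3 + 4) * F.L : ℕ) : ℝ) ^ 2) :
    ContinuousOn (minActionRegPr F n K hnK.le ε₀) {V | PlaqSmall ε₁ V} := by
  subst hF
  haveI : T2Space (GaugeField (F.P n) 0 (Matrix.specialUnitaryGroup (Fin 2) ℂ)) :=
    inferInstanceAs (T2Space (PBond (F.P n) 0 → Matrix.specialUnitaryGroup (Fin 2) ℂ))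
  have hε₀ : 0 < ε₀ := (mul_pos hB₃ hε₁).trans hlo
  have hL0 : (0 : ℝ) < (F.L : ℝ) := by exact_mod_cast (show 0 < F.L by have := F.hL.2; omega)
  have hLinv : (0 : ℝ) < (F.L : ℝ)⁻¹ := inv_pos.mpr hL0
  -- letters
  set m : GaugeField (F.P n) 0 (Matrix.specialUnitaryGroup (Fin 2) ℂ) → ℝ := minActionRegPr F n K hnK.le ε₀ with hm_def
  set π : GaugeField (F.P K) 0 (Matrix.specialUnitaryGroup (Fin 2) ℂ) → GaugeField (F.P n) 0 (Matrix.specialUnitaryGroup (Fin 2) ℂ) :=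
    descendTo F ℰp n K hnK.le with hπ_def
  set O₀ : Set (GaugeField (F.P K) 0 (Matrix.specialUnitaryGroup (Fin 2) ℂ)) := {U | RegPr F n K ε₀ U} with hO₀_def
  set C : Set (GaugeField (F.P K) 0 (Matrix.specialUnitaryGroup (Fin 2) ℂ)) :=
    {U | ∀ p : Plaq (F.P K) 0, GaugeGroup.dist1 (GaugeField.plaqHol U p) ≤ regThreshold F n K (B₃ * ε₁)} ∩
      {U | ∀ b : PBond (F.P K) 0, ‖covDivT 1 (unitsField (toUField U)) b.dir b.src‖ ≤ (B₃ * ε₁) * ((F.L : ℝ)⁻¹) ^ (3 * (K - n))}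
    with hC_def
  -- (a) domination on `𝔘_k(ε₀)`: every regular `U` is feasible over its own descent
  have hle : ∀ U ∈ O₀, m (π U) ≤ wilsonAction4 U := fun U hU =>
    minActionRegPr_le F ((mem_regFibrePr_iff F).mpr ⟨(mem_fibre_iff F ℰp).mpr rfl, hU⟩)
  -- (b) the closed class `C` lies inside `𝔘_k(ε₀)` (strict inequality `B₃ε₁ < ε₀`)
  have hthr : regThreshold F n K (B₃ * ε₁) < regThreshold F n K ε₀ := by
    show B₃ * ε₁ * ((F.L : ℝ)⁻¹) ^ (2 * (K - n)) < ε₀ * ((F.L : ℝ)⁻¹) ^ (2 * (K - n))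
    exact mul_lt_mul_of_pos_right hlo (pow_pos hLinv _)
  have hdiv : (B₃ * ε₁) * ((F.L : ℝ)⁻¹) ^ (3 * (K - n)) < ε₀ * ((F.L : ℝ)⁻¹) ^ (3 * (K - n)) :=
    mul_lt_mul_of_pos_right hlo (pow_pos hLinv _)
  have hCO : ∀ U ∈ C, U ∈ O₀ := fun U hU =>
    ⟨fun p => (hU.1 p).trans_lt hthr, fun b => (hU.2 b).trans_lt hdiv⟩
  -- (c) `C` is compact and `π` is continuous on it
  have hCc : IsCompact C := isCompact_of_isClosed_cfg ((isClosed_plaqLe F K _).inter (isClosed_divLe F K _))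
  have hπC : ContinuousOn π C := fun U hU =>
    (continuousAt_descendTo_of_plaqLe F n K hnK.le hε₀ hr3 hr2 (regThreshold_mono F hlo.le) hU.1).continuousWithinAt
  -- (d) Thm 1 (8): the minimum is ATTAINED inside `C` over every datum of the class
  have hatt : ∀ V ∈ {V : GaugeField (F.P n) 0 (Matrix.specialUnitaryGroup (Fin 2) ℂ) | PlaqSmall ε₁ V},
      ∃ U ∈ C, π U = V ∧ wilsonAction4 U = m V := by
    intro V hV
    obtain ⟨U, hU8, hmin⟩ := hT F rfl n K hnK ε₁ ε₀ hε₁ hε₁a hlo.le hhi V hV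
    obtain ⟨hUf, hUpl, hUdv⟩ := (mem_regFibrePr_iff F).mp hU8
    refine ⟨U, ⟨fun p => (hUpl p).le, fun b => (hUdv b).le⟩, (mem_fibre_iff F ℰp).mp hUf, ?_⟩
    exact minActionRegPr_eq_of_isMinOn F (regFibrePr_mono F hlo.le V hU8) hmin
  -- (e) `π` is open on `𝔘_k(ε₀)`: every regular field has a `2ε₀`-small history
  have hτ : ((((F.P K).d + 2) * (F.P K).L : ℕ) : ℝ) ^ 2 / 4 * (2 * ε₀) < deltaSU (Fin 2) :=
    loopRadius_lt_deltaSU (N := 2) (P := F.P K) hε₀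
      (by show 2 * ε₀ ≤ 2 * deltaSU (Fin 2) / (((3 + 4) * F.L : ℕ) : ℝ) ^ 2; linarith)
  have hopen : ∀ O : Set (GaugeField (F.P K) 0 (Matrix.specialUnitaryGroup (Fin 2) ℂ)), IsOpen O → O ⊆ O₀ → IsOpen (π '' O) :=
    fun O hO hOO => isOpen_image_descendTo F hnK.le (by positivity) hτ O hO
      fun U hU i hi => plaqSmall_iter_of_regPr F hε₀ hr3 hr2 (hOO hU) hi.le
  -- assemble: lower and upper semicontinuity at every datum of the class
  intro V₀ hV₀
  rw [continuousWithinAt_iff_lower_upperSemicontinuousWithinAt]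
  refine ⟨lowerSemicontinuousWithinAt_of_isCompact hCc hπC (continuous_wilsonAction4 (N := 2)) (fun U hU => hle U (hCO U hU))
    hatt, ?_⟩
  obtain ⟨U₀, hU₀C, hU₀V, hU₀m⟩ := hatt V₀ hV₀
  have hO₀A : IsOpen {U : GaugeField (F.P K) 0 (Matrix.specialUnitaryGroup (Fin 2) ℂ) | RegPr F n K ε₀ U ∧ wilsonAction4 U < m V₀ + 1} :=
    isOpen_regPr_inter_actionLt F n K ε₀ _
  have husc : UpperSemicontinuousAt m (π U₀) :=
    upperSemicontinuousAt_of_isOpen_image (O₀ := {U | RegPr F n K ε₀ U ∧ wilsonAction4 U < m V₀ + 1}) hO₀A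
      (fun O hO hOO => hopen O hO fun U hU => (hOO hU).1) (fun U hU => hle U hU.1)
      ⟨hCO U₀ hU₀C, by rw [hU₀m]; linarith⟩ (continuous_wilsonAction4 (N := 2)).continuousAt
      (by rw [hU₀V, hU₀m])
  rw [hU₀V] at husc
  exact husc.upperSemicontinuousWithinAt _

end Main

/-! ## §4 Editions: every `L ≥ 5` outright; the window editions in the route's letters -/

section Editions

/-- print's two (53)-admissibility conditions on `2ε₀`, from one threshold `ε₀ ≤ e(L)` (arithmetic). [cite: Balaban1985Averaging, Prop. 2 (53) p.26 (bookkeeping)] -/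
theorem admissible_of_le (L : ℕ) (hL : 1 ≤ L) {ε₀ : ℝ}
    (h : ε₀ ≤ min (1 / (6 * (143 * ((((3 + 4 : ℕ) : ℝ)) ^ 2 / 4) ^ 2))) (deltaSU (Fin 2) / (2 * (((3 + 4) * L : ℕ) : ℝ) ^ 2))) :
    (143 * ((((3 + 4 : ℕ) : ℝ)) ^ 2 / 4) ^ 2) * (2 * ε₀) ≤ 1 / 3 ∧
      2 * (2 * ε₀) ≤ 2 * deltaSU (Fin 2) / (((3 + 4) * L : ℕ) : ℝ) ^ 2 := by
  have hC : (0 : ℝ) < 143 * ((((3 + 4 : ℕ) : ℝ)) ^ 2 / 4) ^ 2 := by positivity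
  have h7 : (0 : ℝ) < (((3 + 4) * L : ℕ) : ℝ) ^ 2 := by
    have : 0 < (3 + 4) * L := by omega
    positivity
  constructor
  · have h1 : ε₀ ≤ 1 / (6 * (143 * ((((3 + 4 : ℕ) : ℝ)) ^ 2 / 4) ^ 2)) := h.trans (min_le_left _ _)
    rw [le_div_iff₀ (by positivity)] at h1
    nlinarith
  · have h2 : ε₀ ≤ deltaSU (Fin 2) / (2 * (((3 + 4) * L : ℕ) : ℝ) ^ 2) := h.trans (min_le_right _ _)
    rw [le_div_iff₀ (by positivity)] at h2
    rw [le_div_iff₀ h7]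
    nlinarith

/-- ★★ **EVERY `L ≥ 5`, ZERO HYPOTHESES**: there are `a₁, B₃, e > 0` (depending on `L` only) such that for every member of the d = 3 family with block size
`L`, every `n < K` and all radii `0 < ε₁ ≤ a₁`, `B₃ε₁ < ε₀ ≤ e`, `V ↦ minActionRegPr F n K _ ε₀ V` is continuous on `{PlaqSmall ε₁}` —
[Balaban1985Variational] Thm 1 (8) being a tree THEOREM there (✓`thm1GlobalMinAt_five`). [cite: Balaban1985Variational, Thm 1 (8) p.279 and Prop 9 p.309] -/
theorem continuousOn_minActionRegPr_five (L : ℕ) (h5 : 5 ≤ L) :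
    ∃ a₁ B₃ e : ℝ, 0 < a₁ ∧ 0 < B₃ ∧ 0 < e ∧ ∀ (F : T3Family), F.L = L → ∀ {n K : ℕ} (hnK : n < K) (ε₁ ε₀ : ℝ),
      0 < ε₁ → ε₁ ≤ a₁ → B₃ * ε₁ < ε₀ → ε₀ ≤ e → ContinuousOn (minActionRegPr F n K hnK.le ε₀) {V | PlaqSmall ε₁ V} := by
  obtain ⟨a₀, a₁, B₃, ha₀, ha₁, hB₃, hT⟩ := thm1GlobalMinAt_five L h5
  have hL : 1 ≤ L := by omega
  set eL : ℝ := min (1 / (6 * (143 * ((((3 + 4 : ℕ) : ℝ)) ^ 2 / 4) ^ 2))) (deltaSU (Fin 2) / (2 * (((3 + 4) * L : ℕ) : ℝ) ^ 2))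
    with heL
  have h7 : (0 : ℝ) < (((3 + 4) * L : ℕ) : ℝ) ^ 2 := by
    have : 0 < (3 + 4) * L := by omega
    positivity
  have heL0 : 0 < eL := lt_min (by positivity) (div_pos deltaSU_pos (by positivity))
  refine ⟨a₁, B₃, min a₀ eL, ha₁, hB₃, lt_min ha₀ heL0, fun F hF n K hnK ε₁ ε₀ hε₁ hε₁a hlo hε₀e => ?_⟩
  obtain ⟨hr3, hr2⟩ := admissible_of_le L hL (hε₀e.trans (min_le_right _ _))
  rw [← hF] at hr2
  exact continuousOn_minActionRegPr F hT hB₃ hF hnK hε₁ hε₁a hlo (hε₀e.trans (min_le_left _ _)) hr3 hr2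

/-- ★★ **WINDOW EDITION FROM THE THM-1 LETTER** (the EX letter's first conjunct, all odd `L > 1`): for every block size `L` and profile `(b₀, p₀)` there is
`ε₁ > 0` such that for every `0 < ε₀ ≤ ε₁` there is a coupling threshold `γ₁` below which, for every member with `F.L = L`, every `J < K`,
`V ↦ minActionRegPr F J K _ ε₀ V` is continuous on the window `{PlaqSmall (θBal F.L γ b₀ p₀ J)}`. [cite: Balaban1985Variational, Thm 1 (8) p.279 and Prop 9 p.309] -/
theorem continuousOn_minActionRegPr_window_of_thm1
    (hT : ∀ L : ℕ, Odd L → 1 < L → ∃ a₀ a₁ B₃ : ℝ, 0 < a₀ ∧ 0 < a₁ ∧ 0 < B₃ ∧ Thm1GlobalMinAt L a₀ a₁ B₃) :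
    ∀ (L : ℕ) (b₀ p₀ : ℝ), 0 < b₀ → 0 < p₀ → ∃ ε₁ : ℝ, 0 < ε₁ ∧ ∀ (ε₀ : ℝ), 0 < ε₀ → ε₀ ≤ ε₁ →
      ∃ γ₁ : ℝ, 0 < γ₁ ∧ ∀ (F : T3Family) (γ : ℝ), F.L = L → 0 < γ → γ ≤ γ₁ →
        ∀ (J K : ℕ) (hJK : J < K), ContinuousOn (minActionRegPr F J K hJK.le ε₀) {V | PlaqSmall (θBal F.L γ b₀ p₀ J) V} := by
  intro L b₀ p₀ hb _
  by_cases hLT : Odd L ∧ 1 < L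
  swap
  · -- no member of the family has this block size
    refine ⟨1, one_pos, fun ε₀ _ _ => ⟨1, one_pos, fun F γ hF _ _ J K hJK => ?_⟩⟩
    exact absurd (hF ▸ F.hL : Odd L ∧ 1 < L) hLT
  obtain ⟨a₀, a₁, B₃, ha₀, ha₁, hB₃, hT1⟩ := hT L hLT.1 hLT.2
  have hL : 1 ≤ L := hLT.2.le
  set eL : ℝ := min (1 / (6 * (143 * ((((3 + 4 : ℕ) : ℝ)) ^ 2 / 4) ^ 2))) (deltaSU (Fin 2) / (2 * (((3 + 4) * L : ℕ) : ℝ) ^ 2))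
    with heL
  have h7 : (0 : ℝ) < (((3 + 4) * L : ℕ) : ℝ) ^ 2 := by
    have : 0 < (3 + 4) * L := by omega
    positivity
  have heL0 : 0 < eL := lt_min (by positivity) (div_pos deltaSU_pos (by positivity))
  refine ⟨min a₀ eL, lt_min ha₀ heL0, fun ε₀ hε₀ hε₀e => ?_⟩
  -- the datum radius: `θBal ≤ min a₁ (ε₀ / (2 B₃))`, so that `B₃·θBal ≤ ε₀/2 < ε₀`
  obtain ⟨γ₀, hγ₀, hθ⟩ := exists_forall_θBal_le hL b₀ p₀ (lt_min ha₁ (div_pos hε₀ (mul_pos two_pos hB₃)))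
  refine ⟨min γ₀ 1, lt_min hγ₀ one_pos, fun F γ hF hγ hγle J K hJK => ?_⟩
  have hγ1 : γ ≤ 1 := hγle.trans (min_le_right _ _)
  have hγ0 : γ ≤ γ₀ := hγle.trans (min_le_left _ _)
  have hLF : 1 ≤ F.L := F.hL.2.le
  have hθJ : θBal F.L γ b₀ p₀ J ≤ min a₁ (ε₀ / (2 * B₃)) := by rw [hF]; exact hθ γ hγ hγ0 J
  have hε₁ : 0 < θBal F.L γ b₀ p₀ J := θBal_pos hLF hγ hγ1 hb p₀ J
  have hlo : B₃ * θBal F.L γ b₀ p₀ J < ε₀ := by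
    have h1 : θBal F.L γ b₀ p₀ J ≤ ε₀ / (2 * B₃) := hθJ.trans (min_le_right _ _)
    rw [le_div_iff₀ (mul_pos two_pos hB₃)] at h1
    nlinarith
  obtain ⟨hr3, hr2⟩ := admissible_of_le L hL (hε₀e.trans (min_le_right _ _))
  rw [← hF] at hr2
  exact continuousOn_minActionRegPr F hT1 hB₃ hF hJK hε₁ (hθJ.trans (min_le_left _ _)) hlo (hε₀e.trans (min_le_left _ _)) hr3 hr2

/-- ★★ **WINDOW EDITION AT EVERY `L ≥ 5`, ZERO LETTERS** (Thm 1 (8) is a tree theorem there): same conclusion as `continuousOn_minActionRegPr_window_of_thm1`.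
[cite: Balaban1985Variational, Thm 1 (8) p.279 and Prop 9 p.309] -/
theorem continuousOn_minActionRegPr_window_five (L : ℕ) (h5 : 5 ≤ L) (b₀ p₀ : ℝ) (hb : 0 < b₀) :
    ∃ ε₁ : ℝ, 0 < ε₁ ∧ ∀ (ε₀ : ℝ), 0 < ε₀ → ε₀ ≤ ε₁ →
      ∃ γ₁ : ℝ, 0 < γ₁ ∧ ∀ (F : T3Family) (γ : ℝ), F.L = L → 0 < γ → γ ≤ γ₁ →
        ∀ (J K : ℕ) (hJK : J < K), ContinuousOn (minActionRegPr F J K hJK.le ε₀) {V | PlaqSmall (θBal F.L γ b₀ p₀ J) V} := by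
  obtain ⟨a₁, B₃, e, ha₁, hB₃, he, hmain⟩ := continuousOn_minActionRegPr_five L h5
  have hL : 1 ≤ L := by omega
  refine ⟨e, he, fun ε₀ hε₀ hε₀e => ?_⟩
  obtain ⟨γ₀, hγ₀, hθ⟩ := exists_forall_θBal_le hL b₀ p₀ (lt_min ha₁ (div_pos hε₀ (mul_pos two_pos hB₃)))
  refine ⟨min γ₀ 1, lt_min hγ₀ one_pos, fun F γ hF hγ hγle J K hJK => ?_⟩
  have hγ1 : γ ≤ 1 := hγle.trans (min_le_right _ _)
  have hγ0 : γ ≤ γ₀ := hγle.trans (min_le_left _ _)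
  have hLF : 1 ≤ F.L := F.hL.2.le
  have hθJ : θBal F.L γ b₀ p₀ J ≤ min a₁ (ε₀ / (2 * B₃)) := by rw [hF]; exact hθ γ hγ hγ0 J
  have hε₁ : 0 < θBal F.L γ b₀ p₀ J := θBal_pos hLF hγ hγ1 hb p₀ J
  have hlo : B₃ * θBal F.L γ b₀ p₀ J < ε₀ := by
    have h1 : θBal F.L γ b₀ p₀ J ≤ ε₀ / (2 * B₃) := hθJ.trans (min_le_right _ _)
    rw [le_div_iff₀ (mul_pos two_pos hB₃)] at h1
    nlinarith
  exact hmain F hF hJK _ ε₀ hε₁ (hθJ.trans (min_le_left _ _)) hlo hε₀e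

end Editions

end Summit.QuantumFields.YangMills.Theorems.FluctuationComparisonRegPrIntLS2BetaMinActionRegPrContinuousOn

end
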